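import Literature.MathematicalPhysics.QuantumFieldTheory.Balaban1983to89.B8Ineq128Rec
import Literature.MathematicalPhysics.QuantumFieldTheory.Balaban1983to89.B8Ineq133

/-!
# `Balaban1983to89.B8Ineq133Rec` — [Balaban1985RegularSpaces] (1.133) p. 99, «`U₀″ = U₀′` on `□̃`, `1` outside», FOR THE RECORD TOWER ([Balaban1987RG1] (0.4)):
# `cutFixedZ` and `ineq133` — the record twin of `B8Ineq133` (LEAD PEN dag-n05-e; cell member dag-n05-d)

statement-level skeleton of published theorems with citation tags; proofs where landed; nothing here is a claim about the Yang–Mills mass gap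

CITATION HEADER.  [6] = [Balaban1985RegularSpaces], p. 99: *«let us define a configuration U₀″ as equal to U₀′ on □̃, and equal to 1 outside □̃. It satisfies the conditions
U₀″ ∈ 𝔄_k({□_j}, L³α₀) ∩ Ax_k(ℭ_k, 1), (1.132)  |Ū₀″ʲ − 1| < 6dL²Mα₀ on □_j^{(j)}, j = 0, 1, …, k, (1.133) by the construction of U₀″, and the inequality (1.130).»*;
[3] = [Balaban1985Averaging] p. 24 (locality of (42)); [I] = [Balaban1987RG1] (0.4) p. 253.  Cell `pub-ymgap`, seat dag-n05-d g23, «N05-REC» road item R4 (TOKEN RULE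
(T1) `avgIter ↦ avgIterZ`, `localGauge ↦ localGaugeZ`, (T2) centred tower `B8Ineq130Rec.tlo ∕ thi`, `boxVec ↦ offZ`, (T5) engine names, definition twin `cutFixed ↦ cutFixedZ`).
REUSED verbatim (class 0, structure-free): `B8Ineq133.cutCfg ∕ cutCfg_agree ∕ cutCfg_eq_one ∕ cutCfg_mem ∕ pdevOn_congr`.  `--kind definition --supports stmt-QuantumFields-20541`
(K0⁷; count-neutral; the one definition is the `abbrev cutFixedZ`).

WHAT IS PROVED (sorry-free).  §1 `avgIterZ_eq_of_agree` (locality of the record averages on the centred tower, bondwise).  §2 `cutFixedZ` (print's `U₀″` as a function of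
`U₀`, record tower) and ★★★ `ineq133` — (i) `G`-valued, (ii) `1` off `□̃`, (iii) (1.7) on `□̃` unchanged, (iv) (1.15) (centred block contours) on the tower + the global axial
gauge at `y`, (v) (1.133) `|Ū₀″^{k−n}(x, x + e_ν) − 1| < 6dL²Mα₀` on every bond of every `□̃^{(k−n)}`.
HONEST SCOPE.  Exactly the engine module's content with the record substitutions (odd `L ≥ 3`, `AvgClosedZ`, `C0Z`); nothing of [6] beyond (1.133)'s construction is asserted;
`HThm4Rec` UNDISCHARGED; N05 ∕ N07 NOT discharged; counts unmoved; one finite 𝕋⁴ programme at fixed ε — nothing continuum ∕ ℝ⁴ ∕ OS ∕ mass gap ∕ Clay.  No `instance`,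
no `notation`, no `sorry`.
-/

noncomputable section

open scoped BigOperators
open NormedSpace Finset

namespace Literature.MathematicalPhysics.QuantumFieldTheory.Balaban1983to89.B8Ineq133Rec

open B7Prop1Explicit MatrixLog BlockAveragingZd B8Lemma1NonAbelianRecLoops B8Lemma1NonAbelianRec B8Ineq130Rec B8Eq115GaugeFixingRec B8Ineq128Rec
open B7Prop2Explicit (pdev c2')
open B7Prop2Rec (AvgClosedZ C0Z)
open B7Prop1Local (InBox AgreeOn clampCfg pdevOn hol_treeWord_congr)
open B8Lemma1NonAbelian (e_nonneg)
open B8Ineq130 (bound130 inBox_of_le axialFn_congr)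
open B7AvgGaugeCovariance (pdev_gaugeAct)
open B8Eq115GaugeFixing (gaugeAct_mem_of pdevOn_gaugeAct)
open B8Ineq133 (cutCfg cutCfg_agree cutCfg_eq_one cutCfg_mem pdevOn_congr)

-- `Site` alone would resolve to the torus sites of `Setup.lean`; re-export the `ℤᵈ` sites of `B7Prop1Explicit`.
export B7Prop1Explicit (Site)

variable {d : ℕ}

variable {𝔸 : Type*} [NormedRing 𝔸] [NormOneClass 𝔸] [NormedAlgebra ℂ 𝔸] [CompleteSpace 𝔸]

/-! ## §1 Locality of the record averages on the centred tower, bondwise -/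

omit [NormOneClass 𝔸] in
/-- (RECORD TWIN of `B8Ineq133.avgIter_eq_of_agree`.) Two configurations agreeing on the bonds of the finest CENTRED cube `[tlo k, thi k]` have equal `(k − n)`-fold record
averages on every bond `⟨x, x + e_ν⟩` of the depth-`n` cube (`B8Ineq130Rec.agree_level`), odd `L`. [cite: Balaban1985Averaging, p.24 (locality of (42)); Balaban1985RegularSpaces, p.99 ("by the construction of U₀″"); Balaban1987RG1, (0.4) p.253] -/
theorem avgIterZ_eq_of_agree {L s : ℕ} (hLs : L = 2 * s + 1) {lo hi : Site d} {k : ℕ} {V V' : Site d → Fin d → 𝔸ˣ}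
    (h : AgreeOn (tlo L lo k) (thi L hi k) V V') {n : ℕ} (hn : n ≤ k) {x : Site d} {ν : Fin d}
    (hx : tlo L lo n ≤ x) (hxν : x + e ν ≤ thi L hi n) :
    avgIterZ L V (k - n) x ν = avgIterZ L V' (k - n) x ν := by
  have hA : AgreeOn (tlo L lo n) (thi L hi n) (avgIterZ L V (k - n)) (avgIterZ L V' (k - n)) :=
    agree_level hLs (k - n) n (by rw [show n + (k - n) = k by omega]; exact h)
  have hxx : x ≤ x + e ν := le_add_of_nonneg_right (e_nonneg ν)
  exact hA x ν (inBox_of_le hx (hxx.trans hxν)) (inBox_of_le (hx.trans hxx) hxν)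

/-! ## §2 `U₀″` and (1.133) for every orbit, record tower -/

/-- (RECORD TWIN of `B8Ineq133.cutFixed`.) PRINT'S `U₀″` AS A FUNCTION OF `U₀` for the record tower: the cut-off to the finest centred cube `□̃ = [tlo k, thi k]` of the
gauge-fixed `U₀′ = U₀^{u}`, `u = localGaugeZ L lo hi U₀ k y` (the (1.15)-tower gauge of `B8Eq115GaugeFixingRec` with the global axial gauge of `Ū₀′ᵏ` on `[lo, hi]` at its
centre `y`). [cite: Balaban1985RegularSpaces, p.98 ("We apply a gauge transformation to U₀ …"), p.99 (definition of U₀″); Balaban1987RG1, (0.4) p.253] -/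
abbrev cutFixedZ (L : ℕ) (lo hi : Site d) (U : Site d → Fin d → 𝔸ˣ) (k : ℕ) (y : Site d) :
    Site d → Fin d → 𝔸ˣ :=
  cutCfg (tlo L lo k) (thi L hi k) (gaugeAct (localGaugeZ L lo hi U k y) U)

/-- **(1.132) [(1.7)- and `Ax`-parts] and (1.133), p. 99, FOR EVERY ORBIT, LOCAL CARRIER, RECORD TOWER** (twin of `B8Ineq133.ineq133`): for every `G`-valued `U₀` (`G`
`AvgClosedZ`) with (1.7) on the unit plaquettes of the finest centred cube `□̃ = [tlo k, thi k]` (`sup |U₀(∂p) − 1| < α₀L²·L^{−2k}`), the record's Prop.-1∕2 smallness, a centre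
`y` of the top cube `[lo, hi]` of half-width `h` with `2h ≤ M + 4R₁M₁`, `R₁M₁ ≤ M`, `11d < M`, `11d²L²α₀ + (M + 4R₁M₁)dL²α₀ ≤ ⅙`, odd `L ≥ 3`, the configuration
`U₀″ = cutFixedZ L lo hi U₀ k y` satisfies: (i) `G`-valued; (ii) `1` on every bond not inside `□̃`; (iii) its deviation (1.7) on `□̃` equals that of `U₀` and is
`< α₀L²·L^{−2k}`; (iv) (1.15) (centred block contours) between all consecutive levels on the tower, and the global axial gauge of `Ū₀″ᵏ` at `y` on `[lo, hi]`; (v) (1.133):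
`|Ū₀″^{k−n}(x, x + e_ν) − 1| < 6dL²Mα₀` on every bond of every depth-`n` cube. [cite: Balaban1985RegularSpaces, (1.132)-(1.133) p.99, (1.130) p.99, (1.15) p.78; Balaban1985Averaging, p.24; Balaban1987RG1, (0.4) p.253] -/
theorem ineq133 {L s : ℕ} (hLs : L = 2 * s + 1) (hL : 2 ≤ L) (hd : 1 ≤ d) {G : Subgroup 𝔸ˣ} (hG : AvgClosedZ d L G) (k : ℕ)
    (U : Site d → Fin d → 𝔸ˣ) (hU : ∀ x κ, U x κ ∈ G) {α₀ : ℝ} (hα : 0 < α₀)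
    (hα3 : C0Z d * (α₀ * (L : ℝ) ^ 2) ≤ 1 / 3) (hα2 : 2 * (α₀ * (L : ℝ) ^ 2) ≤ c2' d L)
    (lo hi : Site d) (hlohi : lo ≤ hi)
    (h17 : pdevOn (tlo L lo k) (thi L hi k) U < α₀ * (L : ℝ) ^ 2 * (((L : ℝ) ^ k)⁻¹) ^ 2)
    {y : Site d} {h : ℕ} (hy : lo ≤ y) (hy' : y ≤ hi) (hrad : ∀ κ, y κ - lo κ ≤ h ∧ hi κ - y κ ≤ h)
    {M R₁ M₁ : ℝ} (hside : 2 * (h : ℝ) ≤ M + 4 * R₁ * M₁) (hRM : R₁ * M₁ ≤ M) (hM : 11 * (d : ℝ) < M)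
    (hsmall : 11 * (d : ℝ) ^ 2 * (L : ℝ) ^ 2 * α₀ + (M + 4 * R₁ * M₁) * d * (L : ℝ) ^ 2 * α₀ ≤ 1 / 6) :
    (∀ x κ, cutFixedZ L lo hi U k y x κ ∈ G) ∧
    (∀ x κ, ¬ (InBox (tlo L lo k) (thi L hi k) x ∧ InBox (tlo L lo k) (thi L hi k) (x + e κ)) →
      cutFixedZ L lo hi U k y x κ = 1) ∧
    (pdevOn (tlo L lo k) (thi L hi k) (cutFixedZ L lo hi U k y) = pdevOn (tlo L lo k) (thi L hi k) U ∧
      pdevOn (tlo L lo k) (thi L hi k) (cutFixedZ L lo hi U k y) < α₀ * (L : ℝ) ^ 2 * (((L : ℝ) ^ k)⁻¹) ^ 2) ∧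
    (∀ n, n < k → ∀ z, tlo L lo n ≤ z → z ≤ thi L hi n → ∀ r : Fin d → Fin L,
      axialFn (avgIterZ L (cutFixedZ L lo hi U k y) (k - (n + 1))) ((L : ℤ) • z) ((L : ℤ) • z + offZ L r) = 1) ∧
    (∀ z, lo ≤ z → z ≤ hi → hol (avgIterZ L (cutFixedZ L lo hi U k y) k) y (treeWord (z - y)) = 1) ∧
    ∀ (n : ℕ), n ≤ k → ∀ (x : Site d) (ν : Fin d), tlo L lo n ≤ x → x + e ν ≤ thi L hi n →
      ‖((avgIterZ L (cutFixedZ L lo hi U k y) (k - n) x ν : 𝔸ˣ) : 𝔸) - 1‖ < 6 * d * (L : ℝ) ^ 2 * M * α₀ := by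
  obtain ⟨huG, h15', hgax', h130⟩ :=
    ineq130_fixed hLs hL hd hG k U hU hα hα3 hα2 lo hi hlohi h17 hy hy' hrad hside hRM hM hsmall
  have huU : ∀ x, localGaugeZ L lo hi U k y x ∈ U1 𝔸 := fun x => hG.le_U1 (huG x)
  have hU' : ∀ x κ, gaugeAct (localGaugeZ L lo hi U k y) U x κ ∈ G := gaugeAct_mem_of hU huG
  have hag : AgreeOn (tlo L lo k) (thi L hi k) (cutFixedZ L lo hi U k y)
      (gaugeAct (localGaugeZ L lo hi U k y) U) := cutCfg_agree _ _ _
  have hdev : pdevOn (tlo L lo k) (thi L hi k) (cutFixedZ L lo hi U k y) = pdevOn (tlo L lo k) (thi L hi k) U := by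
    rw [pdevOn_congr hag, pdevOn_gaugeAct huU]
  refine ⟨fun x κ => cutCfg_mem hU' x κ, fun x κ hxκ => cutCfg_eq_one _ hxκ, ⟨hdev, hdev ▸ h17⟩, ?_, ?_, ?_⟩
  · intro n hn z hz hz' r
    have hA : AgreeOn (tlo L lo (n + 1)) (thi L hi (n + 1)) (avgIterZ L (cutFixedZ L lo hi U k y) (k - (n + 1)))
        (avgIterZ L (gaugeAct (localGaugeZ L lo hi U k y) U) (k - (n + 1))) :=
      agree_level hLs (k - (n + 1)) (n + 1) (by rw [show n + 1 + (k - (n + 1)) = k by omega]; exact hag)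
    obtain ⟨h1, h2⟩ := block_mem hLs hz hz' r
    obtain ⟨h3, h4⟩ := smul_mem (L := L) hz hz'
    rw [axialFn_congr hA _ _ (inBox_of_le h3 h4) (inBox_of_le h1 h2)]
    exact h15' n hn z hz hz' r
  · intro z hz hz'
    have hA : AgreeOn (tlo L lo 0) (thi L hi 0) (avgIterZ L (cutFixedZ L lo hi U k y) k)
        (avgIterZ L (gaugeAct (localGaugeZ L lo hi U k y) U) k) :=
      agree_level hLs k 0 (by rw [zero_add]; exact hag)
    rw [hol_treeWord_congr hA y (z - y) (inBox_of_le hy hy') (by rw [add_sub_cancel]; exact inBox_of_le hz hz')]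
    exact hgax' z hz hz'
  · intro n hn x ν hx hxν
    rw [avgIterZ_eq_of_agree hLs hag hn hx hxν]
    exact (h130 n hn x ν hx hxν).2.2.2

end Literature.MathematicalPhysics.QuantumFieldTheory.Balaban1983to89.B8Ineq133Rec

/-! ## Axiom audit (gate whitelist: `propext`, `Classical.choice`, `Quot.sound`) -/
#print axioms Literature.MathematicalPhysics.QuantumFieldTheory.Balaban1983to89.B8Ineq133Rec.ineq133
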